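import Summits.QuantumFields.YangMills.Theorems.DirichletWindowAllSidesChessboardOddTorusFamilies
import Summits.QuantumFields.YangMills.Theorems.DirichletWindowAllSidesChessboardEvenCore
import Literature.MathematicalPhysics.QuantumFieldTheory.WilsonSiteRPForm
import HarnessLib

/-!
# Plaquette sets of ALL orientations on the even torus — families with the plain dictionary

Support file for item stmt-QuantumFields-20194 (`DirichletWindow.AllSidesCouplingChessboard`, K1 of the large-field
sparsity line; seat ym-dw-p1 g3).  Even-side companion of `…AllSidesChessboardOddTorusFamilies`.

On the even torus `(ℤ/L)^d` a finite set of plaquettes is encoded as a family `A = (A_o)_o` of block patterns with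
the PLAIN dictionary `c ↦ (c, o)` (corner `c`; no row shift): `plaqsE A`.  Under the Osterwalder–Seiler LINK
reflection `ϑ` (`WilsonRP.plaqReflect`, `θ t = 1 - t`) the corner of a plaquette transverse to the axis `0` moves by
the block reflection `cellReflect 0 1` and the corner of a plaquette containing the axis `0` by the site-type block
reflection `sreflect 0 0` (`t ↦ -t`, fixing the two CUT slabs `t = 0, L/2`); under the SITE reflection `ϑ'`
(`WilsonSiteRP.sitePlaqReflect`, `θ' t = -t`) it is the other way round: `sreflect 0 0` on transverse plaquettes
(fixing the two SHARED layers `t = 0, L/2`) and `cellReflect 0 0` on in-plane ones (`plaqsE_reflect_link`,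
`plaqsE_reflect_site`).  Also: the Chebyshev functional `Ψ(A) = ⟨exp(c ∑_{q ∈ plaqsE A} φ_q)⟩_{Λ,β}` (`mpsiE`) and its
invariance under translations and the axis exchange.  Finite bookkeeping; no claim about the mass gap.
-/

noncomputable section

open MeasureTheory Finset
open Literature.MathematicalPhysics.QuantumFieldTheory
open Literature.MathematicalPhysics.QuantumFieldTheory.WilsonRP
open Literature.MathematicalPhysics.QuantumFieldTheory.WilsonSiteRP
open Literature.Barriers.CriticalPhenomena.NonGibbs
open Literature.Probability.LatticeModels
open Summit.QuantumFields.YangMills.Theorems.SoloBlind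
open Summit.QuantumFields.YangMills.Theorems.OddTorusChessboard

namespace Summit.QuantumFields.YangMills.Theorems.AllSidesChessboard

variable {d L N : ℕ} [NeZero d] [NeZero L] {G : Type*} [Group G] [TopologicalSpace G]
  [IsTopologicalGroup G] [CompactSpace G] [MeasurableSpace G] [BorelSpace G]
  (ρ : G →* Matrix (Fin N) (Fin N) ℂ)

/-! ### §1. The plain dictionary -/

section Plaqs

omit [NeZero d] [NeZero L] in
/-- The set of plaquettes labelled by a family of corner patterns, one per orientation (plain dictionary). -/
def plaqsE (A : Orient d → Finset (BlockIdx d L)) : Finset (Plaquette d L) :=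
  univ.biUnion fun o => (A o).image fun c => (c, o)

omit [NeZero d] [NeZero L] in
/-- Membership in `plaqsE`. -/
theorem mem_plaqsE {A : Orient d → Finset (BlockIdx d L)} {q : Plaquette d L} :
    q ∈ plaqsE A ↔ q.1 ∈ A q.2 := by
  rw [plaqsE, mem_biUnion]
  constructor
  · rintro ⟨o, -, h⟩
    obtain ⟨c, hc, rfl⟩ := mem_image.1 h
    exact hc
  · intro hq
    exact ⟨q.2, mem_univ _, mem_image.2 ⟨q.1, hq, rfl⟩⟩

omit [NeZero d] [NeZero L] in
/-- `plaqsE` of a componentwise union. -/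
theorem plaqsE_union (X Y : Orient d → Finset (BlockIdx d L)) :
    plaqsE (fun o => X o ∪ Y o) = plaqsE X ∪ plaqsE Y := by
  ext q; simp only [mem_plaqsE, mem_union]

omit [NeZero d] [NeZero L] in
/-- `plaqsE` of a triple componentwise union. -/
theorem plaqsE_union₃ (X F Y : Orient d → Finset (BlockIdx d L)) :
    plaqsE (fun o => X o ∪ F o ∪ Y o) = plaqsE X ∪ plaqsE F ∪ plaqsE Y := by
  rw [← plaqsE_union, ← plaqsE_union]

omit [NeZero d] [NeZero L] in
/-- Componentwise disjoint families have disjoint plaquette sets. -/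
theorem disjoint_plaqsE {X Y : Orient d → Finset (BlockIdx d L)} (h : ∀ o, Disjoint (X o) (Y o)) :
    Disjoint (plaqsE X) (plaqsE Y) := by
  rw [Finset.disjoint_left]
  intro q hX hY
  exact Finset.disjoint_left.1 (h q.2) (mem_plaqsE.1 hX) (mem_plaqsE.1 hY)

omit [NeZero d] in
/-- The plaquette set of the full family is every plaquette. -/
theorem plaqsE_top : plaqsE (fun _ : Orient d => (univ : Finset (BlockIdx d L))) = univ := by
  ext q; simp [mem_plaqsE]

omit [NeZero d] [NeZero L] in
/-- The cardinality of `plaqsE A` is the total size of the family. -/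
theorem card_plaqsE (A : Orient d → Finset (BlockIdx d L)) : #(plaqsE A) = ∑ o, #(A o) := by
  rw [plaqsE, card_biUnion]
  · exact sum_congr rfl fun o _ => card_image_of_injective _ fun c c' h => congrArg Prod.fst h
  · intro o _ o' _ hoo'
    rw [Function.onFun, Finset.disjoint_left]
    intro q hq hq'
    obtain ⟨c, -, rfl⟩ := mem_image.1 hq
    obtain ⟨c', -, h⟩ := mem_image.1 hq'
    exact hoo' (congrArg Prod.snd h).symm

omit [NeZero d] [NeZero L] in
/-- Every finite set of plaquettes is `plaqsE` of a family of the same total size. -/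
theorem exists_plaqsE_eq (P : Finset (Plaquette d L)) :
    ∃ A : Orient d → Finset (BlockIdx d L), plaqsE A = P ∧ ∑ o, #(A o) = #P := by
  classical
  refine ⟨fun o => (P.filter fun q => q.2 = o).image Prod.fst, ?_, ?_⟩
  · ext q
    rw [mem_plaqsE, mem_image]
    constructor
    · rintro ⟨q', hq', hq⟩
      obtain ⟨hq'P, hq'o⟩ := mem_filter.1 hq'
      have : q' = q := Prod.ext hq hq'o
      rwa [← this]
    · intro hq
      exact ⟨q, mem_filter.2 ⟨hq, rfl⟩, rfl⟩
  · rw [← card_plaqsE]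
    congr 1
    ext q
    rw [mem_plaqsE, mem_image]
    constructor
    · rintro ⟨q', hq', hq⟩
      obtain ⟨hq'P, hq'o⟩ := mem_filter.1 hq'
      have : q' = q := Prod.ext hq hq'o
      rwa [← this]
    · intro hq
      exact ⟨q, mem_filter.2 ⟨hq, rfl⟩, rfl⟩

omit [NeZero d] [NeZero L] in
/-- The plaquette set of the translated family is the translated plaquette set. -/
theorem plaqsE_translate (k : Fin d) (a : ZMod L) (A : Orient d → Finset (BlockIdx d L)) :
    plaqsE (fun o => (A o).image (cellTranslate k a)) = plaqTranslate (Pi.single k a) (plaqsE A) := by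
  ext q
  rw [plaqTranslate, mem_image, mem_plaqsE, mem_image]
  constructor
  · rintro ⟨c, hc, hcq⟩
    refine ⟨(c, q.2), mem_plaqsE.2 hc, Prod.ext ?_ rfl⟩
    rw [← hcq]
    funext m
    simp only [Pi.add_apply, cellTranslate_apply]
    by_cases h : m = k
    · subst h; simp
    · simp [h]
  · rintro ⟨q₀, hq₀, rfl⟩
    refine ⟨q₀.1, mem_plaqsE.1 hq₀, ?_⟩
    funext m
    simp only [Pi.add_apply, cellTranslate_apply]
    by_cases h : m = k
    · subst h; simp
    · simp [h]

omit [NeZero L] in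
/-- The axis exchange on plaquettes in the plain dictionary. -/
theorem plaqSwap_pair (k : Fin d) (c : BlockIdx d L) (o : Orient d) :
    plaqSwap 0 k (c, o) = (swapIdx k c, oSwap (L := L) k o) :=
  Prod.ext (funext fun m => by simp only [plaqSwap_fst, swapIdx_apply]) (plaqSwap_snd k c o)

omit [NeZero L] in
/-- The plaquette set of the axis-exchanged family is the axis-exchanged plaquette set. -/
theorem plaqsE_swap (k : Fin d) (A : Orient d → Finset (BlockIdx d L)) :
    plaqsE (fun o => (A (oSwap (L := L) k o)).image (swapIdx k)) = (plaqsE A).image (plaqSwap 0 k) := by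
  ext q
  rw [mem_plaqsE, mem_image, mem_image]
  constructor
  · rintro ⟨c, hc, hcq⟩
    refine ⟨(c, oSwap (L := L) k q.2), mem_plaqsE.2 hc, ?_⟩
    rw [plaqSwap_pair, oSwap_oSwap, hcq]
  · rintro ⟨q₀, hq₀, rfl⟩
    rw [show q₀ = (q₀.1, q₀.2) from rfl, plaqSwap_pair]
    refine ⟨q₀.1, ?_, rfl⟩
    simp only
    rw [oSwap_oSwap]
    exact mem_plaqsE.1 hq₀

omit [NeZero L] in
/-- The link reflection in the plain dictionary: `cellReflect 0 1` on transverse corners, `sreflect 0 0` on in-plane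
ones. -/
theorem plaqReflect_pair (c : BlockIdx d L) (o : Orient d) :
    plaqReflect (c, o) = (if o.1.1 = 0 then sreflect 0 0 c else cellReflect 0 1 c, o) := by
  refine Prod.ext ?_ rfl
  simp only [plaqReflect]
  by_cases ho : o.1.1 = 0
  · rw [if_pos ho, if_pos ho]
    funext m
    by_cases hm : m = 0
    · subst hm
      rw [timeReflect_apply_zero, shift_apply_self, sreflect_apply, Function.update_self]; ring
    · rw [timeReflect_apply_of_ne _ hm, shift_apply_of_ne _ hm, sreflect_apply_of_ne 0 0 c hm]
  · rw [if_neg ho, if_neg ho]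
    funext m
    by_cases hm : m = 0
    · subst hm
      rw [timeReflect_apply_zero, cellReflect_apply, Function.update_self]; ring
    · rw [timeReflect_apply_of_ne _ hm, cellReflect_apply_of_ne 0 1 c hm]

omit [NeZero L] in
/-- The site reflection in the plain dictionary: `sreflect 0 0` on transverse corners, `cellReflect 0 0` on in-plane
ones. -/
theorem sitePlaqReflect_pair (c : BlockIdx d L) (o : Orient d) :
    sitePlaqReflect (c, o) = (if o.1.1 = 0 then cellReflect 0 0 c else sreflect 0 0 c, o) := by
  refine Prod.ext ?_ rfl
  simp only [sitePlaqReflect]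
  by_cases ho : o.1.1 = 0
  · rw [if_pos ho, if_pos ho]
    funext m
    by_cases hm : m = 0
    · subst hm
      rw [negReflect_apply_zero, shift_apply_self, cellReflect_apply, Function.update_self]; ring
    · rw [negReflect_apply_of_ne _ hm, shift_apply_of_ne _ hm, cellReflect_apply_of_ne 0 0 c hm]
  · rw [if_neg ho, if_neg ho]
    funext m
    by_cases hm : m = 0
    · subst hm
      rw [negReflect_apply_zero, sreflect_apply, Function.update_self]; ring
    · rw [negReflect_apply_of_ne _ hm, sreflect_apply_of_ne 0 0 c hm]

omit [NeZero L] in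
/-- **The link-reflected plaquette set of a family.** -/
theorem plaqsE_reflect_link (X : Orient d → Finset (BlockIdx d L)) :
    plaqsE (fun o => if o.1.1 = 0 then (X o).image (sreflect 0 0) else (X o).image (cellReflect 0 1)) =
      (plaqsE X).image plaqReflect := by
  ext q
  rw [mem_plaqsE, mem_image]
  constructor
  · intro hq
    by_cases ho : q.2.1.1 = 0
    · rw [if_pos ho, mem_image] at hq
      obtain ⟨c, hc, hcq⟩ := hq
      refine ⟨(c, q.2), mem_plaqsE.2 hc, ?_⟩
      rw [plaqReflect_pair, if_pos ho, hcq]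
    · rw [if_neg ho, mem_image] at hq
      obtain ⟨c, hc, hcq⟩ := hq
      refine ⟨(c, q.2), mem_plaqsE.2 hc, ?_⟩
      rw [plaqReflect_pair, if_neg ho, hcq]
  · rintro ⟨q₀, hq₀, rfl⟩
    rw [show q₀ = (q₀.1, q₀.2) from rfl, plaqReflect_pair]
    by_cases ho : q₀.2.1.1 = 0
    · simp only [ho, ↓reduceIte, mem_image]
      exact ⟨q₀.1, mem_plaqsE.1 hq₀, rfl⟩
    · simp only [ho, ↓reduceIte, mem_image]
      exact ⟨q₀.1, mem_plaqsE.1 hq₀, rfl⟩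

omit [NeZero L] in
/-- **The site-reflected plaquette set of a family.** -/
theorem plaqsE_reflect_site (X : Orient d → Finset (BlockIdx d L)) :
    plaqsE (fun o => if o.1.1 = 0 then (X o).image (cellReflect 0 0) else (X o).image (sreflect 0 0)) =
      (plaqsE X).image sitePlaqReflect := by
  ext q
  rw [mem_plaqsE, mem_image]
  constructor
  · intro hq
    by_cases ho : q.2.1.1 = 0
    · rw [if_pos ho, mem_image] at hq
      obtain ⟨c, hc, hcq⟩ := hq
      refine ⟨(c, q.2), mem_plaqsE.2 hc, ?_⟩
      rw [sitePlaqReflect_pair, if_pos ho, hcq]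
    · rw [if_neg ho, mem_image] at hq
      obtain ⟨c, hc, hcq⟩ := hq
      refine ⟨(c, q.2), mem_plaqsE.2 hc, ?_⟩
      rw [sitePlaqReflect_pair, if_neg ho, hcq]
  · rintro ⟨q₀, hq₀, rfl⟩
    rw [show q₀ = (q₀.1, q₀.2) from rfl, sitePlaqReflect_pair]
    by_cases ho : q₀.2.1.1 = 0
    · simp only [ho, ↓reduceIte, mem_image]
      exact ⟨q₀.1, mem_plaqsE.1 hq₀, rfl⟩
    · simp only [ho, ↓reduceIte, mem_image]
      exact ⟨q₀.1, mem_plaqsE.1 hq₀, rfl⟩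

end Plaqs

/-! ### §2. The functional -/

/-- **The chessboard functional of a family (plain dictionary)**: `Ψ(A) = ⟨exp(c ∑_{q ∈ plaqsE A} φ_q)⟩_{Λ,β}`. -/
def mpsiE (β c : ℝ) (A : Orient d → Finset (BlockIdx d L)) : ℝ :=
  wilsonExpectation ρ β (expObs (G := G) ρ c (plaqsE A))

omit [NeZero d] in
/-- `Ψ ≥ 0`. -/
theorem mpsiE_nonneg (β c : ℝ) (A : Orient d → Finset (BlockIdx d L)) : 0 ≤ mpsiE (G := G) ρ β c A :=
  wilsonExpectation_expObs_nonneg ρ β c _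

omit [NeZero d] in
/-- **Translation invariance** of `Ψ`. -/
theorem mpsiE_translate (β c : ℝ) (k : Fin d) (a : ZMod L) (A : Orient d → Finset (BlockIdx d L)) :
    mpsiE (G := G) ρ β c (fun o => (A o).image (cellTranslate k a)) = mpsiE ρ β c A := by
  unfold mpsiE
  rw [plaqsE_translate, wilsonExpectation_expObs_plaqTranslate]

/-- **Axis-exchange invariance** of `Ψ`. -/
theorem mpsiE_swap (hρ : Continuous ρ) (β c : ℝ) (k : Fin d) (A : Orient d → Finset (BlockIdx d L)) :
    mpsiE (G := G) ρ β c (fun o => (A (oSwap (L := L) k o)).image (swapIdx k)) = mpsiE ρ β c A := by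
  unfold mpsiE
  rw [plaqsE_swap, wilsonExpectation_expObs_swap ρ hρ]

/-! ### §3. The site-reflection Cauchy–Schwarz inequality for real half-observables -/

section SiteCS

/-- **Site reflection positivity, real form**: `0 ≤ ∫ F · F∘Θ' dμ_{Λ,β}` for a bounded measurable real observable of
the links of the closed half `0 ≤ t ≤ L/2` (`L` even, every real `β`). -/
theorem integral_mul_negReflect_nonneg' (hL : Even L) (hρ : Continuous ρ) (β : ℝ)
    {F : GaugeConfig d L G → ℝ} (hFm : Measurable F) {F₀ : ℝ} (hFb : ∀ U, |F U| ≤ F₀)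
    (hFdep : DependsOn F ((sitePosEdges ∪ sharedEdges : Finset (Edge d L)) : Set (Edge d L))) :
    0 ≤ ∫ U, F U * F U.negReflect ∂(wilsonMeasure ρ β) := by
  haveI : Fact (1 < L) := ⟨by obtain ⟨r, hr⟩ := hL; have := NeZero.ne L; omega⟩
  have hdep : DependsOn (fun U : GaugeConfig d L G => (F U : ℂ))
      ((sitePosEdges ∪ sharedEdges : Finset (Edge d L)) : Set (Edge d L)) := by
    intro U V hUV
    simp only [Complex.ofReal_inj]
    exact hFdep hUV
  have h := wilsonExpectation_siteReflectionPositive ρ hL hρ β (fun U => (F U : ℂ))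
    (Complex.measurable_ofReal.comp hFm) ⟨F₀, fun U => by
      rw [Complex.norm_real, Real.norm_eq_abs]; exact hFb U⟩ hdep
  unfold wilsonExpectation at h
  have h' : (∫ U, (starRingEnd ℂ) ((F U.negReflect : ℝ) : ℂ) * (F U : ℂ) ∂wilsonMeasure ρ β) =
      ((∫ U, F U * F U.negReflect ∂wilsonMeasure ρ β : ℝ) : ℂ) := by
    rw [← integral_complex_ofReal]
    refine integral_congr_ae (ae_of_all _ fun U => ?_)
    simp only [Complex.conj_ofReal]
    push_cast
    ring
  rw [h'] at h
  exact Complex.zero_le_real.1 h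

/-- **The site-reflection Cauchy–Schwarz inequality for real half-observables**:
`(∫ X · Y∘Θ')² ≤ (∫ X · X∘Θ') (∫ Y · Y∘Θ')` (`L` even, every real `β`). -/
theorem sq_integral_mul_negReflect_le (hL : Even L) (hρ : Continuous ρ) (β : ℝ)
    {X : GaugeConfig d L G → ℝ} (hXm : Measurable X) {X₀ : ℝ} (hXb : ∀ U, |X U| ≤ X₀)
    (hXdep : DependsOn X ((sitePosEdges ∪ sharedEdges : Finset (Edge d L)) : Set (Edge d L)))
    {Y : GaugeConfig d L G → ℝ} (hYm : Measurable Y) {Y₀ : ℝ} (hYb : ∀ U, |Y U| ≤ Y₀)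
    (hYdep : DependsOn Y ((sitePosEdges ∪ sharedEdges : Finset (Edge d L)) : Set (Edge d L))) :
    (∫ U, X U * Y U.negReflect ∂(wilsonMeasure ρ β)) ^ 2 ≤
      (∫ U, X U * X U.negReflect ∂(wilsonMeasure ρ β)) * (∫ U, Y U * Y U.negReflect ∂(wilsonMeasure ρ β)) := by
  haveI : Fact (1 < L) := ⟨by obtain ⟨r, hr⟩ := hL; have := NeZero.ne L; omega⟩
  haveI := isProbabilityMeasure_wilsonMeasure (d := d) (L := L) (G := G) ρ hρ β
  have hΘm : Measurable (GaugeConfig.negReflect : GaugeConfig d L G → GaugeConfig d L G) := measurable_negReflect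
  have hX0 : 0 ≤ X₀ := (abs_nonneg _).trans (hXb fun _ => 1)
  have hY0 : 0 ≤ Y₀ := (abs_nonneg _).trans (hYb fun _ => 1)
  set a := ∫ U, X U * X U.negReflect ∂(wilsonMeasure ρ β) with ha
  set b := ∫ U, X U * Y U.negReflect ∂(wilsonMeasure ρ β) with hb
  set e := ∫ U, Y U * Y U.negReflect ∂(wilsonMeasure ρ β) with he
  have hsymm : (∫ U, Y U * X U.negReflect ∂(wilsonMeasure ρ β)) = b := by
    rw [hb, ← integral_comp_negReflect_wilsonMeasure ρ hL hρ β (fun U : GaugeConfig d L G => X U * Y U.negReflect)]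
    refine integral_congr_ae (ae_of_all _ fun U => ?_)
    simp only [negReflect_negReflect_config]
    ring
  have hint : ∀ (P Q : GaugeConfig d L G → ℝ), Measurable P → Measurable Q → ∀ (P₀ Q₀ : ℝ),
      (∀ U, |P U| ≤ P₀) → (∀ U, |Q U| ≤ Q₀) →
      Integrable (fun U : GaugeConfig d L G => P U * Q U.negReflect) (wilsonMeasure ρ β) := by
    intro P Q hPm hQm P₀ Q₀ hPb hQb
    refine Integrable.of_bound (hPm.mul (hQm.comp hΘm)).aestronglyMeasurable (P₀ * Q₀)
      (ae_of_all _ fun U => ?_)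
    rw [Real.norm_eq_abs, abs_mul]
    exact mul_le_mul (hPb U) (hQb _) (abs_nonneg _) ((abs_nonneg _).trans (hPb U))
  have hquad : ∀ t : ℝ, 0 ≤ e * (t * t) + (2 * b) * t + a := by
    intro t
    have hHm : Measurable fun U => X U + t * Y U := hXm.add (hYm.const_mul t)
    have hHb : ∀ U, |X U + t * Y U| ≤ X₀ + |t| * Y₀ := fun U =>
      (abs_add_le _ _).trans (add_le_add (hXb U) (by rw [abs_mul]; exact mul_le_mul_of_nonneg_left (hYb U) (abs_nonneg t)))
    have hHdep : DependsOn (fun U => X U + t * Y U)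
        ((sitePosEdges ∪ sharedEdges : Finset (Edge d L)) : Set (Edge d L)) :=
      fun U V hUV => by simp only; rw [hXdep hUV, hYdep hUV]
    have h := integral_mul_negReflect_nonneg' ρ hL hρ β hHm hHb hHdep
    have e1 : (fun U : GaugeConfig d L G => (X U + t * Y U) * (X U.negReflect + t * Y U.negReflect)) = fun U =>
        (X U * X U.negReflect + t * (X U * Y U.negReflect)) +
        (t * (Y U * X U.negReflect) + t * t * (Y U * Y U.negReflect)) := by
      funext U; ring
    have iXX := hint X X hXm hXm X₀ X₀ hXb hXb
    have iXY := hint X Y hXm hYm X₀ Y₀ hXb hYb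
    have iYX := hint Y X hYm hXm Y₀ X₀ hYb hXb
    have iYY := hint Y Y hYm hYm Y₀ Y₀ hYb hYb
    have i3 : Integrable (fun U : GaugeConfig d L G => t * (X U * Y U.negReflect)) (wilsonMeasure ρ β) :=
      iXY.const_mul t
    have i4 : Integrable (fun U : GaugeConfig d L G => t * (Y U * X U.negReflect)) (wilsonMeasure ρ β) :=
      iYX.const_mul t
    have i5 : Integrable (fun U : GaugeConfig d L G => t * t * (Y U * Y U.negReflect)) (wilsonMeasure ρ β) :=
      iYY.const_mul _
    have i1 : Integrable (fun U : GaugeConfig d L G => X U * X U.negReflect + t * (X U * Y U.negReflect))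
        (wilsonMeasure ρ β) := iXX.add i3
    have i2 : Integrable (fun U : GaugeConfig d L G =>
        t * (Y U * X U.negReflect) + t * t * (Y U * Y U.negReflect)) (wilsonMeasure ρ β) := i4.add i5
    have hexp : (∫ U, (X U + t * Y U) * (X U.negReflect + t * Y U.negReflect) ∂(wilsonMeasure ρ β)) =
        a + t * b + t * (∫ U, Y U * X U.negReflect ∂(wilsonMeasure ρ β)) + t * t * e := by
      rw [e1, integral_add i1 i2, integral_add iXX i3, integral_add i4 i5, integral_const_mul, integral_const_mul,
        integral_const_mul, ha, hb, he]
      ring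
    rw [hexp, hsymm] at h
    nlinarith [h]
  have hdisc := discrim_le_zero hquad
  rw [discrim] at hdisc
  nlinarith [hdisc]

end SiteCS

end Summit.QuantumFields.YangMills.Theorems.AllSidesChessboard

end
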